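import Mathlib
import Summits.Ventures.PercRepro2.TypedBasesStar
import Summits.Ventures.PercRepro2.TypedSplit

/-!
# Class sums as re-opened counts (blind cell PercRepro2, night-3 g16, 2026-08-27)

The class sum `typedClassCount F z τ S x₀ y₀ w₀ K` (TypedBasesStar.lean: the typed count restricted
to the triples agreeing with the colouring `(x₀, y₀, w₀)` on the star `S`) is a typed count over a
SMALLER typed set: peeling one edge `e ∈ S` off, the class equals the class on `S ∖ e` of the count
over `F ∖ e` (pinned closed at `e`) of the kernel re-opened at `e` as the colouring prescribes —
provided the colouring at `e` has the type `τ e`, and `0` otherwise (`typedClassCount_insert_eq`).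
Iterated over the star, every class sum is a plain typed count over `F ∖ S` with the kernel
re-opened on `S` (`typedClassCount_pair_eq` for a two-edge star). This is the bridge between the
class vocabulary of (TRI-o) / (TRI-oM) and the reduction calculus (`typedCount_split`); it is the
class-sum twin of `typedCount_split`. Own work; standard axioms.
-/

namespace Summit.Ventures.PercRepro2

namespace CovForm

section Reopen

variable {E : Type*} [Fintype E] [DecidableEq E] {R : Type*} [Field R]

open TypedRed

/-- A sum over configurations of a function supported on `{x e = a}` is the sum over the
configurations closed at `e` of the function re-opened at `e` to `a`. -/
lemma sum_fix_edge (e : E) (a : Bool) (g : Config E → R) (hg : ∀ x, x e ≠ a → g x = 0) :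
    (∑ x : Config E, g x) = ∑ x : Config E, if x e = false then g (Function.update x e a) else 0 := by
  rw [sum_split_edge e g, Fintype.sum_bool]
  cases a
  · simp only [add_eq_right]
    refine Finset.sum_eq_zero fun x _ => ?_
    split_ifs with hx
    · exact hg _ (by simp)
    · rfl
  · simp only [add_eq_left]
    refine Finset.sum_eq_zero fun x _ => ?_
    split_ifs with hx
    · exact hg _ (by simp)
    · rfl

omit [Fintype E] in
/-- Agreement on `insert e S` of the copies re-opened at `e` from configurations closed at `e`. -/
lemma agree_insert_update {S : Finset E} {e : E} (heS : e ∉ S) (x y w x₀ y₀ w₀ : Config E)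
    (a b c : Bool) :
    (∀ e' ∈ insert e S, Function.update x e a e' = x₀ e' ∧ Function.update y e b e' = y₀ e' ∧
        Function.update w e c e' = w₀ e') ↔
      (a = x₀ e ∧ b = y₀ e ∧ c = w₀ e) ∧ (∀ e' ∈ S, x e' = x₀ e' ∧ y e' = y₀ e' ∧ w e' = w₀ e') := by
  constructor
  · intro h
    refine ⟨?_, fun e' he' => ?_⟩
    · have := h e (Finset.mem_insert_self e S)
      simpa only [Function.update_self] using this
    · have hne : e' ≠ e := fun h' => heS (h' ▸ he')
      have := h e' (Finset.mem_insert_of_mem he')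
      simpa only [Function.update_of_ne hne] using this
  · rintro ⟨⟨ha, hb, hc⟩, hS⟩ e' he'
    rcases Finset.mem_insert.1 he' with rfl | he'
    · simp only [Function.update_self]; exact ⟨ha, hb, hc⟩
    · have hne : e' ≠ e := fun h' => heS (h' ▸ he')
      simp only [Function.update_of_ne hne]; exact hS e' he'

/-- **Peeling one edge of the star off a class sum**: for `e ∈ F`, `e ∉ S`, the class of the
colouring `(x₀, y₀, w₀)` on `insert e S` is the class on `S` of the count over `F ∖ e` (pinned closed
at `e`) of the kernel re-opened at `e` to `(x₀ e, y₀ e, w₀ e)` — if that colouring has the type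
`τ e`, and `0` otherwise. -/
theorem typedClassCount_insert_eq (F : Finset E) (e : E) (he : e ∈ F) (S : Finset E) (heS : e ∉ S)
    (z : Config E) (τ : E → ℕ) (x₀ y₀ w₀ : Config E) (K : Config E → Config E → Config E → R) :
    typedClassCount F z τ (insert e S) x₀ y₀ w₀ K =
      if (x₀ e).toNat + (y₀ e).toNat + (w₀ e).toNat = τ e then
        typedClassCount (F.erase e) (Function.update z e false) τ S x₀ y₀ w₀
          (fun x y w => K (Function.update x e (x₀ e)) (Function.update y e (y₀ e))
            (Function.update w e (w₀ e)))
      else 0 := by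
  unfold typedClassCount
  -- the summand of the left side vanishes unless the copies agree with the colouring at `e`
  set C : Config E → Config E → Config E → R := fun x y w =>
    if ((∀ e', e' ∉ F → x e' = z e' ∧ y e' = z e' ∧ w e' = z e') ∧
          (∀ e' ∈ F, openCount x y w e' = τ e')) ∧
        (∀ e' ∈ insert e S, x e' = x₀ e' ∧ y e' = y₀ e' ∧ w e' = w₀ e')
      then K x y w else 0 with hC
  have hCx : ∀ x y w, x e ≠ x₀ e → C x y w = 0 := fun x y w hx => by
    simp only [hC]
    split_ifs with h
    · exact absurd (h.2 e (Finset.mem_insert_self e S)).1 hx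
    · rfl
  have hCy : ∀ x y w, y e ≠ y₀ e → C x y w = 0 := fun x y w hy => by
    simp only [hC]
    split_ifs with h
    · exact absurd (h.2 e (Finset.mem_insert_self e S)).2.1 hy
    · rfl
  have hCw : ∀ x y w, w e ≠ w₀ e → C x y w = 0 := fun x y w hw => by
    simp only [hC]
    split_ifs with h
    · exact absurd (h.2 e (Finset.mem_insert_self e S)).2.2 hw
    · rfl
  show (∑ x, ∑ y, ∑ w, C x y w) = _
  rw [sum_fix_edge e (x₀ e) (fun x => ∑ y, ∑ w, C x y w)
    (fun x hx => Finset.sum_eq_zero fun y _ => Finset.sum_eq_zero fun w _ => hCx x y w hx)]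
  simp only [ite_sum]
  -- the inner sums: fix `y` and `w` the same way
  have step : ∀ x : Config E,
      (∑ y, ∑ w, if x e = false then C (Function.update x e (x₀ e)) y w else 0) =
        ∑ y, ∑ w, if x e = false then if y e = false then if w e = false then
          C (Function.update x e (x₀ e)) (Function.update y e (y₀ e)) (Function.update w e (w₀ e))
          else 0 else 0 else 0 := by
    intro x
    by_cases hx : x e = false
    · simp only [hx, if_true]
      rw [sum_fix_edge e (y₀ e) (fun y => ∑ w, C (Function.update x e (x₀ e)) y w)
        (fun y hy => Finset.sum_eq_zero fun w _ => hCy _ y w hy)]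
      simp only [ite_sum]
      refine Finset.sum_congr rfl fun y _ => ?_
      by_cases hy : y e = false
      · simp only [hy, if_true]
        exact sum_fix_edge e (w₀ e) _ (fun w hw => hCw _ _ w hw)
      · simp [hy]
    · simp [hx]
  simp only [step]
  -- compare the summands
  refine Finset.sum_congr rfl fun x _ => ?_
  refine Finset.sum_congr rfl fun y _ => ?_
  refine Finset.sum_congr rfl fun w _ => ?_
  by_cases hx : x e = false
  · by_cases hy : y e = false
    · by_cases hw : w e = false
      · simp only [hx, hy, hw, if_true, hC]
        simp only [cond_split F e he z τ x y w hx hy hw, agree_insert_update heS, true_and,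
          and_assoc, ite_and]
      · rw [if_pos hx, if_pos hy, if_neg hw]
        split_ifs with h0 h1
        · exact absurd (by simpa using (h1.1.1 e (by simp)).2.2) hw
        · rfl
        · rfl
    · rw [if_pos hx, if_neg hy]
      split_ifs with h0 h1
      · exact absurd (by simpa using (h1.1.1 e (by simp)).2.1) hy
      · rfl
      · rfl
  · rw [if_neg hx]
    split_ifs with h0 h1
    · exact absurd (by simpa using (h1.1.1 e (by simp)).1) hx
    · rfl
    · rfl

/-- **A one-edge star**: the class of a colouring at `e ∈ F` is the count over `F ∖ e` of the kernel
re-opened at `e` as the colouring prescribes, if that colouring has the type `τ e`, and `0`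
otherwise. -/
theorem typedClassCount_singleton_eq (F : Finset E) (e : E) (he : e ∈ F) (z : Config E)
    (τ : E → ℕ) (x₀ y₀ w₀ : Config E) (K : Config E → Config E → Config E → R) :
    typedClassCount F z τ {e} x₀ y₀ w₀ K =
      if (x₀ e).toNat + (y₀ e).toNat + (w₀ e).toNat = τ e then
        typedCount (F.erase e) (Function.update z e false) τ
          (fun x y w => K (Function.update x e (x₀ e)) (Function.update y e (y₀ e))
            (Function.update w e (w₀ e)))
      else 0 := by
  rw [← Finset.insert_empty, typedClassCount_insert_eq F e he ∅ (Finset.notMem_empty e),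
    typedClassCount_empty]

/-- **A two-edge star**: the class of a colouring at `e ≠ f ∈ F` is the count over `F ∖ {e, f}`
(both pinned closed) of the kernel re-opened at `f` then at `e` as the colouring prescribes, if
the colouring has the types `τ e`, `τ f`, and `0` otherwise. -/
theorem typedClassCount_pair_eq (F : Finset E) (e f : E) (he : e ∈ F) (hf : f ∈ F) (hef : e ≠ f)
    (z : Config E) (τ : E → ℕ) (x₀ y₀ w₀ : Config E) (K : Config E → Config E → Config E → R) :
    typedClassCount F z τ {e, f} x₀ y₀ w₀ K =
      if (x₀ e).toNat + (y₀ e).toNat + (w₀ e).toNat = τ e ∧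
          (x₀ f).toNat + (y₀ f).toNat + (w₀ f).toNat = τ f then
        typedCount ((F.erase e).erase f) (Function.update (Function.update z e false) f false) τ
          (fun x y w => K (Function.update (Function.update x f (x₀ f)) e (x₀ e))
            (Function.update (Function.update y f (y₀ f)) e (y₀ e))
            (Function.update (Function.update w f (w₀ f)) e (w₀ e)))
      else 0 := by
  have hfe : f ∈ F.erase e := Finset.mem_erase.2 ⟨hef.symm, hf⟩
  rw [typedClassCount_insert_eq F e he {f} (by simpa using hef),
    typedClassCount_singleton_eq (F.erase e) f hfe]
  by_cases h1 : (x₀ e).toNat + (y₀ e).toNat + (w₀ e).toNat = τ e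
  · by_cases h2 : (x₀ f).toNat + (y₀ f).toNat + (w₀ f).toNat = τ f
    · simp only [h1, h2, and_self, if_true]
    · simp only [h1, h2, and_false, if_true, if_false]
  · simp only [h1, false_and, if_false]

end Reopen

end CovForm

end Summit.Ventures.PercRepro2
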